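import Mathlib
import Summits.ResolutionOfSingularities.ResolutionOfSingularities.Theses.HomologicalConductor
import Summits.ResolutionOfSingularities.ResolutionOfSingularities.Theorems.HomologicalConductorPersistenceSurfaceOfLocalCore
import Summits.ResolutionOfSingularities.ResolutionOfSingularities.Theorems.HomologicalConductorPersistenceRadicalTower
import Literature.RingTheory.CohomologyAnnihilator.Basic
import HarnessLib

/-!
# Line `core` of item `HomologicalConductor.PersistenceSurface` (stmt-ResolutionOfSingularities-19970) —
# rung S-2 from ONE local membership at surface stages (skeleton v2)

`[OURS · L1 w44b]` chain W4.4b (crux planner res-L1-w44b-plan-1, gen 6; CRUX-PLAN v5 §4.1). Replaces the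
role of no printed item; NOT a statement of the manuscript under review; AI-drafted bookkeeping over
LANDED tree lemmas (weaker than expert review). v2 (03:4xZ) consumes stub-3's landed composition
`PersistenceSurfaceOfLocalCore.persistence_route_of_localCore` (p489451, `--supports` 19970); v1 (02:58Z,
evidence on 19970/16484) carried its own composition proof and is superseded.

Rung S-2 `PersistenceSurface` is the crux `Persistence` (stmt-ResolutionOfSingularities-16484) VERBATIM under
the extra binder `ringKrullDim ↥A ≤ 2`. Exactly as for the crux (registered line
`Cruxes/Persistence/Lines/birth.lean`, reshape 4, stub `stub_localChartPersistence`), the tower statement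
reduces to ONE LOCAL MEMBERSHIP per stage, here at stages of Krull dimension `≤ 2`:

* `stub_localChartPersistenceSurface` (OPEN; the surface core; = the hypothesis `hcore` of
  `persistence_route_of_localCore` at `d = 2`, verbatim): for `k ⊆ O`, `B ⊆ O` local, dominated by `O`,
  essentially of finite type over `k`, `Frac B = K`, **`ringKrullDim ↥B ≤ 2`**, and `x ∈ ca B`, `x ≠ 0` of
  minimal `O`-value on `ca B`: `x ∈ ca (loc O (nrm (B[ca B / x])))` (`NoZeno.Birth.{ca, loc, nrm}` = the
  route's `let`s). It is the registered all-dimension stub of the crux with TWO added binders (`k ⊆ O`,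
  `dim B ≤ 2`): `localCoreSurface_of_allDimCore` (proved; vocabularies agree by `ca_eq_image`,
  `loc_eq_locAt`, `nrm_eq_nrm`). METHODS per point class of the normalised chart (CRUX-PLAN v5 §4):
  rational stages — programme M-rat (cycle inequality `Z_ca(T)|_C ≥ Z_ca(T_C)` via THEOREM Q-rat of chain
  W4.4 + Leray restriction + Wunram extension; RDP towers 6/6 KEPT by hand); non-rational stages — open,
  decisive specimen `U_x(E₁₂)` (Σ6). Radical version PROVED (`PersistenceRadical.radicalPersistence_locAt_holds`);
  dimension `≤ 1` PROVED (`PersistenceDimOne`).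
* `PersistenceSurface_of` (the skeleton theorem; concludes the route decl BY NAME; the only `sorry` in its
  closure is the stub): re-abstract the route's `let`s (ζ/δ) and apply `persistence_route_of_localCore 2`.

References: Iyengar–Takahashi, IMRN 2016 [`IyengarTakahashi2014`] Def. 2.1, Lemma 2.10, Thm. 5.4;
Esentepe [`Esentepe2018`] Thm. 5.1 (nearest print: weak MCM-extending property); OURS (chain files under
run/shared/lean/pub/res-hironaka/L/w44b/).
-/

-- single-problem summit: the doubled namespace component `ResolutionOfSingularities` is forced
set_option linter.dupNamespace false

noncomputable section

open Summit.ResolutionOfSingularities.ResolutionOfSingularities.Theses.HomologicalConductor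
open Summit.ResolutionOfSingularities.ResolutionOfSingularities.Theorems
open Summit.ResolutionOfSingularities.ResolutionOfSingularities.Theorems.NoZeno.Birth
open Summit.ResolutionOfSingularities.ResolutionOfSingularities.Theorems.HomologicalConductor.PersistenceRadical
  (ca_eq_image)
open Summit.ResolutionOfSingularities.ResolutionOfSingularities.Theorems.HomologicalConductor.PersistenceSurfaceOfLocalCore
  (persistence_route_of_localCore)

namespace Summit.ResolutionOfSingularities.ResolutionOfSingularities.Cruxes.PersistenceSurface.Lines.Core

/-! ## The one open stub: the local surface core -/

/-- **STUB (open) — local chart persistence at surface stages (the surface core).** For fields `k ⊆ K`,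
a valuation ring `O ⊇ k` of `K`, a local subalgebra `B ⊆ O` essentially of finite type over `k` with
`Frac B = K`, dominated by `O`, of Krull dimension `≤ 2`, and `x ∈ ca B` nonzero of minimal `O`-value on
`ca B`: `x` lies in `ca` of the normalised affine `ca`-chart `B[ca B/x]` localised at the centre of `O`.
This is the hypothesis `hcore` of `persistence_route_of_localCore` at `d = 2` verbatim, and the registered
all-dimension stub `stub_localChartPersistence` (Cruxes/Persistence/Lines/birth.lean r4) with two added
binders (`localCoreSurface_of_allDimCore`). Known: radically (`radicalPersistence_locAt_holds`); for
`dim B ≤ 1` (`PersistenceCoreReduction.H_b_curveCase`). Open at: non-rational normal surface points with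
small `ca` upstairs (specimen `U_x(E₁₂)`); at rational points programme M-rat (CRUX-PLAN v5 §4.2).
[cite: IyengarTakahashi2014, Def 2.1, Lemma 2.10; Esentepe2018, Thm 5.1] -/
theorem stub_localChartPersistenceSurface : ∀ (k K : Type) [Field k] [Field K] [Algebra k K]
    (O : ValuationSubring K) (B : Subalgebra k K) (x : K), (∀ c : k, algebraMap k K c ∈ O) →
    Algebra.EssFiniteType k ↥B → IsFractionRing ↥B K → IsLocalRing ↥B → B.toSubring ≤ O.toSubring →
    (∀ b : K, b ∈ B → b⁻¹ ∈ O → b⁻¹ ∈ B) → ringKrullDim ↥B ≤ 2 →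
    x ∈ ca B → x ≠ 0 → (∀ c ∈ ca B, c * x⁻¹ ∈ O) →
    x ∈ ca (loc O (nrm (Algebra.adjoin k ((B : Set K) ∪ {y : K | ∃ c ∈ ca B, y = c * x⁻¹})))) := by
  sorry

/-! ## The stub is the registered all-dimension core with two added binders (proved) -/

/-- **S-2 core ⇐ all-dimension core.** The registered stub `stub_localChartPersistence` of
`Cruxes/Persistence/Lines/birth.lean` (reshape 4; statement copied verbatim as the hypothesis, in the
`(↑) '' cohomologyAnnihilator` / `SyzygyFlattening.{locAt, nrm}` vocabulary) implies the surface core: drop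
the binders `k ⊆ O`, `dim B ≤ 2` and transport along `ca_eq_image`, `loc_eq_locAt`, `nrm_eq_nrm`.
[cite: IyengarTakahashi2014, Def 2.1] -/
theorem localCoreSurface_of_allDimCore
    (hcore : ∀ (k K : Type) [Field k] [Field K] [Algebra k K]
      (O : ValuationSubring K) (B : Subalgebra k K) (x : K), Algebra.EssFiniteType k ↥B →
      IsFractionRing ↥B K → IsLocalRing ↥B → B.toSubring ≤ O.toSubring →
      (∀ b : K, b ∈ B → b⁻¹ ∈ O → b⁻¹ ∈ B) →
      x ∈ ((↑) : ↥B → K) ''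
        (Literature.RingTheory.CohomologyAnnihilator.cohomologyAnnihilator ↥B : Set ↥B) → x ≠ 0 →
      (∀ c ∈ ((↑) : ↥B → K) ''
        (Literature.RingTheory.CohomologyAnnihilator.cohomologyAnnihilator ↥B : Set ↥B), c * x⁻¹ ∈ O) →
      x ∈ ((↑) : ↥(SyzygyFlattening.locAt O (SyzygyFlattening.nrm
            (Algebra.adjoin k ((B : Set K) ∪ {y : K | ∃ c ∈ ((↑) : ↥B → K) ''
              (Literature.RingTheory.CohomologyAnnihilator.cohomologyAnnihilator ↥B : Set ↥B),
              y = c * x⁻¹})))) → K) ''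
        (Literature.RingTheory.CohomologyAnnihilator.cohomologyAnnihilator
          ↥(SyzygyFlattening.locAt O (SyzygyFlattening.nrm
            (Algebra.adjoin k ((B : Set K) ∪ {y : K | ∃ c ∈ ((↑) : ↥B → K) ''
              (Literature.RingTheory.CohomologyAnnihilator.cohomologyAnnihilator ↥B : Set ↥B),
              y = c * x⁻¹})))) : Set _)) :
    ∀ (k K : Type) [Field k] [Field K] [Algebra k K]
      (O : ValuationSubring K) (B : Subalgebra k K) (x : K), (∀ c : k, algebraMap k K c ∈ O) →
      Algebra.EssFiniteType k ↥B → IsFractionRing ↥B K → IsLocalRing ↥B → B.toSubring ≤ O.toSubring →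
      (∀ b : K, b ∈ B → b⁻¹ ∈ O → b⁻¹ ∈ B) → ringKrullDim ↥B ≤ 2 →
      x ∈ ca B → x ≠ 0 → (∀ c ∈ ca B, c * x⁻¹ ∈ O) →
      x ∈ ca (loc O (nrm (Algebra.adjoin k ((B : Set K) ∪ {y : K | ∃ c ∈ ca B, y = c * x⁻¹})))) := by
  intro k K _ _ _ O B x _ hBft hBfrac hBloc hBO hdom _ hx hx0 hmin
  have hx' := hx
  have hmin' := hmin
  rw [ca_eq_image B] at hx' hmin'
  have h := hcore k K O B x hBft hBfrac hBloc hBO hdom hx' hx0 hmin'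
  simp only [loc_eq_locAt, nrm_eq_nrm]
  rw [ca_eq_image B, ca_eq_image]
  exact h

/-! ## The composition: the item from the stub -/

/-- **The item `PersistenceSurface` (stmt-ResolutionOfSingularities-19970), assembled from the stub** (the
skeleton theorem: concludes the route decl BY NAME; the only `sorry` in its closure is
`stub_localChartPersistenceSurface`). The route decl re-abstracts, by ζ/δ-reduction alone, to the
conclusion of `persistence_route_of_localCore 2` (p489451); `p`, `CharP k p` are decorative, as for the crux
(`Cruxes/Persistence/Disproof.lean` `persistence_of_charFree`). [cite: IyengarTakahashi2014, Lemma 2.10] -/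
theorem PersistenceSurface_of : PersistenceSurface := by
  intro p hp k K _ _ _ _ O A hk hA hfr hAO hdimA ca loc chart nrm tower m
  show NoZeno.Birth.ca (NoZeno.Birth.tower O A m) ⊆ NoZeno.Birth.ca (NoZeno.Birth.tower O A (m + 1))
  exact persistence_route_of_localCore 2 stub_localChartPersistenceSurface p hp k K O A hk hA hfr hAO
    hdimA m

end Summit.ResolutionOfSingularities.ResolutionOfSingularities.Cruxes.PersistenceSurface.Lines.Core

end
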